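import Summits.CriticalPhenomena.PercolationContinuityZ3.Theorems.PercNearOneGluingNoHeavyLowerTailKnQuestion8CoefficientwiseCoreClassDomPocketFree
import HarnessLib

/-!
# Domination maps tensorise under parallel composition at the terminals

Support file (`--supports stmt-CriticalPhenomena-4575`, closed), prover `prim-cplus-coupling` (gen 30).  No definitions, no notations, no named facts,
no sorries; standard axioms.  Memo `prim-cplus-coupling/A5-COUPLING-gen30.md` §1.3.  Companions `…CoreClassDom` (THEOREM KB-DOM), `…CoreClassDomPocketFree`
(THEOREM R_A-DOM), `…CoreClassDomBundle` (THEOREM BUNDLE).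

Setting: a multigraph `ends : ι → Sym2 V`, two DISJOINT edge sets `E₁, E₂` whose edges share no vertex other than the terminals `a ≠ b` (the parallel
composition `H = H₁ ∥ H₂` at `{a, b}`), colourings `ω ⊆ E₁ ∪ E₂`, `C_v(·) = openCluster`.
* `Coefficientwise.openCluster_subset_union_of_sep` — on `{o ∉ C_r(c)}` (`{r, o} = {a, b}`) the cluster of a terminal splits along the parts:
  `C_r(c) ⊆ C_r(c ∩ E₁) ∪ C_r(c ∩ E₂)` (a red path leaving one part passes through the other terminal).
* `Coefficientwise.dom_parallel_cov` / `dom_parallel_inj` / `dom_parallel_sub` — if `ψ_s` is a domination map of `(E_s; a, b)` (`s = 1, 2`: inside `E_s`,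
  injective on the wall event of `(E_s; a, b)`, `C_a(ω_s) ∪ C_b(E_s ∖ ω_s) ⊆ C_a(ψ_s ω_s) ∪ C_b(ψ_s ω_s)` there), then
  `ψ(ω) := ψ₁(ω ∩ E₁) ∪ ψ₂(ω ∩ E₂)` is a domination map of `(E₁ ∪ E₂; a, b)`.
* `Coefficientwise.cwpa_coreClass_of_dom_parallel` — hence CW-PA (all monotone `f, g`) on the core class `N(x) = N(z) = {a, b}` over `H₁ ∥ H₂` whenever
  both parts carry domination maps (e.g. both pocket-free, `…CoreClassDomPocketFree`; or one a bundle and the other with `a` joined to all its vertices but `b`).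
[cite: KozmaNitzan2024, Questions 8–9 (§5.5 p. 36) (context: the Question-8 pocket covariance programme)]
-/

namespace Summit.CriticalPhenomena.PercolationContinuityZ3.Theorems

open Finset Literature.Probability.Percolation

namespace Coefficientwise

variable {ι V : Type*}

open Classical in
/-- **Cluster splitting across a 2-separation.**  If the edges of `E₁` and `E₂` share no vertex other than `r, o`, `c ⊆ E₁ ∪ E₂` and `o ∉ C_r(c)`, then
`C_r(c) ⊆ C_r(c ∩ E₁) ∪ C_r(c ∩ E₂)`. [cite: KozmaNitzan2024, §5.5 (context only; folklore)] -/
theorem openCluster_subset_union_of_sep (ends : ι → Sym2 V) (E₁ E₂ c : Finset ι) (r o : V)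
    (hsep : ∀ i ∈ E₁, ∀ j ∈ E₂, ∀ v, v ∈ ends i → v ∈ ends j → v = r ∨ v = o)
    (hc : c ⊆ E₁ ∪ E₂) (ho : o ∉ openCluster (ends '' (↑c : Set ι)) r) :
    openCluster (ends '' (↑c : Set ι)) r ⊆ openCluster (ends '' (↑(c ∩ E₁) : Set ι)) r ∪ openCluster (ends '' (↑(c ∩ E₂) : Set ι)) r := by
  set S : Set V := openCluster (ends '' (↑(c ∩ E₁) : Set ι)) r ∪ openCluster (ends '' (↑(c ∩ E₂) : Set ι)) r with hS
  have hS1 : openCluster (ends '' (↑(c ∩ E₁) : Set ι)) r ⊆ openCluster (ends '' (↑c : Set ι)) r := openCluster_image_mono ends Finset.inter_subset_left r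
  have hS2 : openCluster (ends '' (↑(c ∩ E₂) : Set ι)) r ⊆ openCluster (ends '' (↑c : Set ι)) r := openCluster_image_mono ends Finset.inter_subset_left r
  refine openCluster_subset_of_closed ends c r (S := S) (Or.inl (mem_openCluster_self _ _)) ?_
  intro i hi u v he hu
  have hiE : i ∈ E₁ ∨ i ∈ E₂ := Finset.mem_union.mp (hc hi)
  -- generic step: `u` in the part-`A` cluster, edge `i` in part `B`
  have step : ∀ (A B : Finset ι), (∀ i ∈ A, ∀ j ∈ B, ∀ v, v ∈ ends i → v ∈ ends j → v = r ∨ v = o) →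
      openCluster (ends '' (↑(c ∩ A) : Set ι)) r ⊆ openCluster (ends '' (↑c : Set ι)) r →
      i ∈ B → u ∈ openCluster (ends '' (↑(c ∩ A) : Set ι)) r → v ∈ openCluster (ends '' (↑(c ∩ B) : Set ι)) r := by
    intro A B hAB hAsub hiB huA
    have hiB' : i ∈ c ∩ B := Finset.mem_inter.mpr ⟨hi, hiB⟩
    by_cases hur : u = r
    · rw [hur] at he
      exact mem_openCluster_of_edge ends hiB' he (mem_openCluster_self _ _)
    · exfalso
      obtain ⟨j, hj, huj⟩ := exists_edge_of_mem_openCluster ends huA hur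
      have hui : u ∈ ends i := by rw [he]; exact Sym2.mem_mk_left u v
      rcases hAB j (Finset.mem_inter.mp hj).2 i hiB u huj hui with h | h
      · exact hur h
      · rw [h] at huA; exact ho (hAsub huA)
  rcases hu with hu | hu
  · rcases hiE with hiE | hiE
    · exact Or.inl (mem_openCluster_of_edge ends (Finset.mem_inter.mpr ⟨hi, hiE⟩) he hu)
    · exact Or.inr (step E₁ E₂ hsep hS1 hiE hu)
  · rcases hiE with hiE | hiE
    · exact Or.inl (step E₂ E₁ (fun i hi j hj v hvi hvj => hsep j hj i hi v hvj hvi) hS2 hiE hu)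
    · exact Or.inr (mem_openCluster_of_edge ends (Finset.mem_inter.mpr ⟨hi, hiE⟩) he hu)

open Classical in
/-- Wall events restrict to a part: if `b ∉ C_a(c)` and `b ∉ C_a((E₁ ∪ E₂) ∖ c)` then the same holds for `c ∩ E_s` inside `E_s ⊆ E₁ ∪ E₂`.
[cite: KozmaNitzan2024, §5.5 (context only)] -/
theorem wall_restrict (ends : ι → Sym2 V) (E Es c : Finset ι) (a b : V) (hEs : Es ⊆ E)
    (hbR : b ∉ openCluster (ends '' (↑c : Set ι)) a) (hbB : b ∉ openCluster (ends '' (↑(E \ c) : Set ι)) a) :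
    b ∉ openCluster (ends '' (↑(c ∩ Es) : Set ι)) a ∧ b ∉ openCluster (ends '' (↑(Es \ (c ∩ Es)) : Set ι)) a := by
  refine ⟨fun h => hbR (openCluster_image_mono ends Finset.inter_subset_left a h),
    fun h => hbB (openCluster_image_mono ends (fun i hi => ?_) a h)⟩
  rw [Finset.mem_sdiff, Finset.mem_inter] at hi
  exact Finset.mem_sdiff.mpr ⟨hEs hi.1, fun h' => hi.2 ⟨h', hi.1⟩⟩

section parallel

variable (ends : ι → Sym2 V) (E₁ E₂ : Finset ι) (a b : V) (ψ₁ ψ₂ : Finset ι → Finset ι)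

open Classical in
/-- **Parallel composition of domination maps: coverage.**  With `ψ(ω) = ψ₁(ω ∩ E₁) ∪ ψ₂(ω ∩ E₂)`, on the wall event of `(E₁ ∪ E₂; a, b)`:
`C_a(ω) ∪ C_b((E₁ ∪ E₂) ∖ ω) ⊆ C_a(ψ ω) ∪ C_b(ψ ω)`. [cite: KozmaNitzan2024, §5.5 (context only)] -/
theorem dom_parallel_cov
    (hsep : ∀ i ∈ E₁, ∀ j ∈ E₂, ∀ v, v ∈ ends i → v ∈ ends j → v = a ∨ v = b)
    (h₁ : ∀ ω, ω ⊆ E₁ → b ∉ openCluster (ends '' (↑ω : Set ι)) a → b ∉ openCluster (ends '' (↑(E₁ \ ω) : Set ι)) a →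
      openCluster (ends '' (↑ω : Set ι)) a ∪ openCluster (ends '' (↑(E₁ \ ω) : Set ι)) b ⊆
        openCluster (ends '' (↑(ψ₁ ω) : Set ι)) a ∪ openCluster (ends '' (↑(ψ₁ ω) : Set ι)) b)
    (h₂ : ∀ ω, ω ⊆ E₂ → b ∉ openCluster (ends '' (↑ω : Set ι)) a → b ∉ openCluster (ends '' (↑(E₂ \ ω) : Set ι)) a →
      openCluster (ends '' (↑ω : Set ι)) a ∪ openCluster (ends '' (↑(E₂ \ ω) : Set ι)) b ⊆
        openCluster (ends '' (↑(ψ₂ ω) : Set ι)) a ∪ openCluster (ends '' (↑(ψ₂ ω) : Set ι)) b)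
    (ω : Finset ι) (hω : ω ⊆ E₁ ∪ E₂) (hbR : b ∉ openCluster (ends '' (↑ω : Set ι)) a)
    (hbB : b ∉ openCluster (ends '' (↑((E₁ ∪ E₂) \ ω) : Set ι)) a) :
    openCluster (ends '' (↑ω : Set ι)) a ∪ openCluster (ends '' (↑((E₁ ∪ E₂) \ ω) : Set ι)) b ⊆
      openCluster (ends '' (↑(ψ₁ (ω ∩ E₁) ∪ ψ₂ (ω ∩ E₂)) : Set ι)) a ∪ openCluster (ends '' (↑(ψ₁ (ω ∩ E₁) ∪ ψ₂ (ω ∩ E₂)) : Set ι)) b := by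
  -- complements inside the parts
  have hc1 : (E₁ ∪ E₂) \ ω ∩ E₁ = E₁ \ (ω ∩ E₁) := by
    ext i; simp only [Finset.mem_inter, Finset.mem_sdiff, Finset.mem_union]; tauto
  have hc2 : (E₁ ∪ E₂) \ ω ∩ E₂ = E₂ \ (ω ∩ E₂) := by
    ext i; simp only [Finset.mem_inter, Finset.mem_sdiff, Finset.mem_union]; tauto
  obtain ⟨w1R, w1B⟩ := wall_restrict ends (E₁ ∪ E₂) E₁ ω a b Finset.subset_union_left hbR hbB
  obtain ⟨w2R, w2B⟩ := wall_restrict ends (E₁ ∪ E₂) E₂ ω a b Finset.subset_union_right hbR hbB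
  have cov1 := h₁ (ω ∩ E₁) Finset.inter_subset_right w1R w1B
  have cov2 := h₂ (ω ∩ E₂) Finset.inter_subset_right w2R w2B
  -- monotonicity into the union
  have m1a := openCluster_image_mono ends (Finset.subset_union_left : ψ₁ (ω ∩ E₁) ⊆ ψ₁ (ω ∩ E₁) ∪ ψ₂ (ω ∩ E₂)) a
  have m1b := openCluster_image_mono ends (Finset.subset_union_left : ψ₁ (ω ∩ E₁) ⊆ ψ₁ (ω ∩ E₁) ∪ ψ₂ (ω ∩ E₂)) b
  have m2a := openCluster_image_mono ends (Finset.subset_union_right : ψ₂ (ω ∩ E₂) ⊆ ψ₁ (ω ∩ E₁) ∪ ψ₂ (ω ∩ E₂)) a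
  have m2b := openCluster_image_mono ends (Finset.subset_union_right : ψ₂ (ω ∩ E₂) ⊆ ψ₁ (ω ∩ E₁) ∪ ψ₂ (ω ∩ E₂)) b
  -- splitting of the two clusters
  have splitR := openCluster_subset_union_of_sep ends E₁ E₂ ω a b hsep hω hbR
  have haB : a ∉ openCluster (ends '' (↑((E₁ ∪ E₂) \ ω) : Set ι)) b :=
    fun h => hbB ((mem_openCluster_comm ends ((E₁ ∪ E₂) \ ω) a b).mpr h)
  have splitB := openCluster_subset_union_of_sep ends E₁ E₂ ((E₁ ∪ E₂) \ ω) b a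
    (fun i hi j hj v hvi hvj => (hsep i hi j hj v hvi hvj).symm) Finset.sdiff_subset haB
  rw [hc1, hc2] at splitB
  intro y hy
  rcases hy with hy | hy
  · rcases splitR hy with hy | hy
    · rcases cov1 (Or.inl hy) with h | h
      · exact Or.inl (m1a h)
      · exact Or.inr (m1b h)
    · rcases cov2 (Or.inl hy) with h | h
      · exact Or.inl (m2a h)
      · exact Or.inr (m2b h)
  · rcases splitB hy with hy | hy
    · rcases cov1 (Or.inr hy) with h | h
      · exact Or.inl (m1a h)
      · exact Or.inr (m1b h)
    · rcases cov2 (Or.inr hy) with h | h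
      · exact Or.inl (m2a h)
      · exact Or.inr (m2b h)

open Classical in
/-- **Parallel composition of domination maps: injectivity** on the wall event of `(E₁ ∪ E₂; a, b)` (`E₁`, `E₂` disjoint).
[cite: KozmaNitzan2024, §5.5 (context only)] -/
theorem dom_parallel_inj (hdisj : Disjoint E₁ E₂)
    (h₁E : ∀ ω, ω ⊆ E₁ → b ∉ openCluster (ends '' (↑ω : Set ι)) a → b ∉ openCluster (ends '' (↑(E₁ \ ω) : Set ι)) a → ψ₁ ω ⊆ E₁)
    (h₂E : ∀ ω, ω ⊆ E₂ → b ∉ openCluster (ends '' (↑ω : Set ι)) a → b ∉ openCluster (ends '' (↑(E₂ \ ω) : Set ι)) a → ψ₂ ω ⊆ E₂)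
    (h₁inj : ∀ ω₁ ω₂, ω₁ ⊆ E₁ → b ∉ openCluster (ends '' (↑ω₁ : Set ι)) a → b ∉ openCluster (ends '' (↑(E₁ \ ω₁) : Set ι)) a →
      ω₂ ⊆ E₁ → b ∉ openCluster (ends '' (↑ω₂ : Set ι)) a → b ∉ openCluster (ends '' (↑(E₁ \ ω₂) : Set ι)) a → ψ₁ ω₁ = ψ₁ ω₂ → ω₁ = ω₂)
    (h₂inj : ∀ ω₁ ω₂, ω₁ ⊆ E₂ → b ∉ openCluster (ends '' (↑ω₁ : Set ι)) a → b ∉ openCluster (ends '' (↑(E₂ \ ω₁) : Set ι)) a →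
      ω₂ ⊆ E₂ → b ∉ openCluster (ends '' (↑ω₂ : Set ι)) a → b ∉ openCluster (ends '' (↑(E₂ \ ω₂) : Set ι)) a → ψ₂ ω₁ = ψ₂ ω₂ → ω₁ = ω₂)
    (ω ω' : Finset ι) (hω : ω ⊆ E₁ ∪ E₂) (hbR : b ∉ openCluster (ends '' (↑ω : Set ι)) a)
    (hbB : b ∉ openCluster (ends '' (↑((E₁ ∪ E₂) \ ω) : Set ι)) a)
    (hω' : ω' ⊆ E₁ ∪ E₂) (hbR' : b ∉ openCluster (ends '' (↑ω' : Set ι)) a)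
    (hbB' : b ∉ openCluster (ends '' (↑((E₁ ∪ E₂) \ ω') : Set ι)) a)
    (heq : ψ₁ (ω ∩ E₁) ∪ ψ₂ (ω ∩ E₂) = ψ₁ (ω' ∩ E₁) ∪ ψ₂ (ω' ∩ E₂)) : ω = ω' := by
  obtain ⟨w1R, w1B⟩ := wall_restrict ends (E₁ ∪ E₂) E₁ ω a b Finset.subset_union_left hbR hbB
  obtain ⟨w2R, w2B⟩ := wall_restrict ends (E₁ ∪ E₂) E₂ ω a b Finset.subset_union_right hbR hbB
  obtain ⟨w1R', w1B'⟩ := wall_restrict ends (E₁ ∪ E₂) E₁ ω' a b Finset.subset_union_left hbR' hbB'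
  obtain ⟨w2R', w2B'⟩ := wall_restrict ends (E₁ ∪ E₂) E₂ ω' a b Finset.subset_union_right hbR' hbB'
  have s1 := h₁E _ Finset.inter_subset_right w1R w1B
  have s2 := h₂E _ Finset.inter_subset_right w2R w2B
  have s1' := h₁E _ Finset.inter_subset_right w1R' w1B'
  have s2' := h₂E _ Finset.inter_subset_right w2R' w2B'
  have dj : ∀ i, i ∈ E₁ → i ∈ E₂ → False := fun i h1 h2 => Finset.disjoint_left.mp hdisj h1 h2
  -- project the equality onto each part
  have e1 : ψ₁ (ω ∩ E₁) = ψ₁ (ω' ∩ E₁) := by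
    ext i
    constructor
    · intro hi
      have : i ∈ ψ₁ (ω' ∩ E₁) ∪ ψ₂ (ω' ∩ E₂) := heq ▸ Finset.mem_union_left _ hi
      rcases Finset.mem_union.mp this with h' | h'
      · exact h'
      · exact (dj i (s1 hi) (s2' h')).elim
    · intro hi
      have : i ∈ ψ₁ (ω ∩ E₁) ∪ ψ₂ (ω ∩ E₂) := heq.symm ▸ Finset.mem_union_left _ hi
      rcases Finset.mem_union.mp this with h' | h'
      · exact h'
      · exact (dj i (s1' hi) (s2 h')).elim
  have e2 : ψ₂ (ω ∩ E₂) = ψ₂ (ω' ∩ E₂) := by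
    ext i
    constructor
    · intro hi
      have : i ∈ ψ₁ (ω' ∩ E₁) ∪ ψ₂ (ω' ∩ E₂) := heq ▸ Finset.mem_union_right _ hi
      rcases Finset.mem_union.mp this with h' | h'
      · exact (dj i (s1' h') (s2 hi)).elim
      · exact h'
    · intro hi
      have : i ∈ ψ₁ (ω ∩ E₁) ∪ ψ₂ (ω ∩ E₂) := heq.symm ▸ Finset.mem_union_right _ hi
      rcases Finset.mem_union.mp this with h' | h'
      · exact (dj i (s1 h') (s2' hi)).elim
      · exact h'
  have q1 := h₁inj _ _ Finset.inter_subset_right w1R w1B Finset.inter_subset_right w1R' w1B' e1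
  have q2 := h₂inj _ _ Finset.inter_subset_right w2R w2B Finset.inter_subset_right w2R' w2B' e2
  have dec : ∀ (c : Finset ι), c ⊆ E₁ ∪ E₂ → c = c ∩ E₁ ∪ c ∩ E₂ := by
    intro c hc; ext i
    simp only [Finset.mem_union, Finset.mem_inter]
    constructor
    · intro hi
      rcases Finset.mem_union.mp (hc hi) with h | h
      · exact Or.inl ⟨hi, h⟩
      · exact Or.inr ⟨hi, h⟩
    · rintro (⟨h, _⟩ | ⟨h, _⟩) <;> exact h
  rw [dec ω hω, dec ω' hω', q1, q2]

open Classical in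
/-- **Parallel composition of domination maps: the image stays inside `E₁ ∪ E₂`.** [cite: KozmaNitzan2024, §5.5 (context only)] -/
theorem dom_parallel_sub
    (h₁E : ∀ ω, ω ⊆ E₁ → b ∉ openCluster (ends '' (↑ω : Set ι)) a → b ∉ openCluster (ends '' (↑(E₁ \ ω) : Set ι)) a → ψ₁ ω ⊆ E₁)
    (h₂E : ∀ ω, ω ⊆ E₂ → b ∉ openCluster (ends '' (↑ω : Set ι)) a → b ∉ openCluster (ends '' (↑(E₂ \ ω) : Set ι)) a → ψ₂ ω ⊆ E₂)
    (ω : Finset ι) (hbR : b ∉ openCluster (ends '' (↑ω : Set ι)) a)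
    (hbB : b ∉ openCluster (ends '' (↑((E₁ ∪ E₂) \ ω) : Set ι)) a) :
    ψ₁ (ω ∩ E₁) ∪ ψ₂ (ω ∩ E₂) ⊆ E₁ ∪ E₂ := by
  obtain ⟨w1R, w1B⟩ := wall_restrict ends (E₁ ∪ E₂) E₁ ω a b Finset.subset_union_left hbR hbB
  obtain ⟨w2R, w2B⟩ := wall_restrict ends (E₁ ∪ E₂) E₂ ω a b Finset.subset_union_right hbR hbB
  exact Finset.union_subset_union (h₁E _ Finset.inter_subset_right w1R w1B) (h₂E _ Finset.inter_subset_right w2R w2B)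

end parallel

open Classical in
/-- **CW-PA on the core class over a parallel composition whose parts carry domination maps.**  Core class as in `cwpa_coreClass_of_dom` with middle
edge set `E_H = E₁ ∪ E₂` (`E₁, E₂` disjoint, their edges sharing no vertex except `a, b`); if `ψ₁, ψ₂` are domination maps of `(E₁; a, b)`, `(E₂; a, b)`,
then for all monotone `f, g`: `0 ≤ Σ_{s ⊆ E₀ : z ∉ C_x(s), z ∉ C_x(E₀∖s)} f(C_x s)·(g(C_x s) − g(C_x(E₀∖s)))`.
[cite: KozmaNitzan2024, Questions 8–9 (§5.5 p. 36) (context)] -/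
theorem cwpa_coreClass_of_dom_parallel (ends : ι → Sym2 V) (E₁ E₂ E₀ : Finset ι) (x z a b : V) (ixa ixb iza izb : ι)
    (hxa : ends ixa = s(x, a)) (hxb : ends ixb = s(x, b)) (hza : ends iza = s(z, a)) (hzb : ends izb = s(z, b))
    (hH : ∀ i ∈ E₁ ∪ E₂, x ∉ ends i ∧ z ∉ ends i) (hE₀ : ∀ i, i ∈ E₀ ↔ i ∈ E₁ ∪ E₂ ∨ i = ixa ∨ i = ixb ∨ i = iza ∨ i = izb)
    (hnot : ixa ∉ E₁ ∪ E₂ ∧ ixb ∉ E₁ ∪ E₂ ∧ iza ∉ E₁ ∪ E₂ ∧ izb ∉ E₁ ∪ E₂)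
    (hd : ixa ≠ ixb ∧ ixa ≠ iza ∧ ixa ≠ izb ∧ ixb ≠ iza ∧ ixb ≠ izb ∧ iza ≠ izb)
    (hxz : x ≠ z) (hxa' : x ≠ a) (hxb' : x ≠ b) (hza' : z ≠ a) (hzb' : z ≠ b)
    (hdisj : Disjoint E₁ E₂) (hsep : ∀ i ∈ E₁, ∀ j ∈ E₂, ∀ v, v ∈ ends i → v ∈ ends j → v = a ∨ v = b)
    (ψ₁ ψ₂ : Finset ι → Finset ι)
    (h₁E : ∀ ω, ω ⊆ E₁ → b ∉ openCluster (ends '' (↑ω : Set ι)) a → b ∉ openCluster (ends '' (↑(E₁ \ ω) : Set ι)) a → ψ₁ ω ⊆ E₁)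
    (h₁cov : ∀ ω, ω ⊆ E₁ → b ∉ openCluster (ends '' (↑ω : Set ι)) a → b ∉ openCluster (ends '' (↑(E₁ \ ω) : Set ι)) a →
      openCluster (ends '' (↑ω : Set ι)) a ∪ openCluster (ends '' (↑(E₁ \ ω) : Set ι)) b ⊆
        openCluster (ends '' (↑(ψ₁ ω) : Set ι)) a ∪ openCluster (ends '' (↑(ψ₁ ω) : Set ι)) b)
    (h₁inj : ∀ ω₁ ω₂, ω₁ ⊆ E₁ → b ∉ openCluster (ends '' (↑ω₁ : Set ι)) a → b ∉ openCluster (ends '' (↑(E₁ \ ω₁) : Set ι)) a →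
      ω₂ ⊆ E₁ → b ∉ openCluster (ends '' (↑ω₂ : Set ι)) a → b ∉ openCluster (ends '' (↑(E₁ \ ω₂) : Set ι)) a → ψ₁ ω₁ = ψ₁ ω₂ → ω₁ = ω₂)
    (h₂E : ∀ ω, ω ⊆ E₂ → b ∉ openCluster (ends '' (↑ω : Set ι)) a → b ∉ openCluster (ends '' (↑(E₂ \ ω) : Set ι)) a → ψ₂ ω ⊆ E₂)
    (h₂cov : ∀ ω, ω ⊆ E₂ → b ∉ openCluster (ends '' (↑ω : Set ι)) a → b ∉ openCluster (ends '' (↑(E₂ \ ω) : Set ι)) a →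
      openCluster (ends '' (↑ω : Set ι)) a ∪ openCluster (ends '' (↑(E₂ \ ω) : Set ι)) b ⊆
        openCluster (ends '' (↑(ψ₂ ω) : Set ι)) a ∪ openCluster (ends '' (↑(ψ₂ ω) : Set ι)) b)
    (h₂inj : ∀ ω₁ ω₂, ω₁ ⊆ E₂ → b ∉ openCluster (ends '' (↑ω₁ : Set ι)) a → b ∉ openCluster (ends '' (↑(E₂ \ ω₁) : Set ι)) a →
      ω₂ ⊆ E₂ → b ∉ openCluster (ends '' (↑ω₂ : Set ι)) a → b ∉ openCluster (ends '' (↑(E₂ \ ω₂) : Set ι)) a → ψ₂ ω₁ = ψ₂ ω₂ → ω₁ = ω₂)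
    (f g : Set V → ℝ) (hf : Monotone f) (hg : Monotone g) :
    0 ≤ ∑ s ∈ E₀.powerset.filter (fun s : Finset ι => z ∉ openCluster (ends '' (↑s : Set ι)) x ∧ z ∉ openCluster (ends '' (↑(E₀ \ s) : Set ι)) x),
      f (openCluster (ends '' (↑s : Set ι)) x) * (g (openCluster (ends '' (↑s : Set ι)) x) - g (openCluster (ends '' (↑(E₀ \ s) : Set ι)) x)) :=
  cwpa_coreClass_of_dom ends (E₁ ∪ E₂) E₀ x z a b ixa ixb iza izb hxa hxb hza hzb hH hE₀ hnot hd hxz hxa' hxb' hza' hzb'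
    (fun ω => ψ₁ (ω ∩ E₁) ∪ ψ₂ (ω ∩ E₂))
    (fun ω _ hbR hbB => dom_parallel_sub ends E₁ E₂ a b ψ₁ ψ₂ h₁E h₂E ω hbR hbB)
    (fun ω hω hbR hbB => dom_parallel_cov ends E₁ E₂ a b ψ₁ ψ₂ hsep h₁cov h₂cov ω hω hbR hbB)
    (fun ω₁ ω₂ h1 h2 h3 h4 h5 h6 h => dom_parallel_inj ends E₁ E₂ a b ψ₁ ψ₂ hdisj h₁E h₂E h₁inj h₂inj ω₁ ω₂ h1 h2 h3 h4 h5 h6 h)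
    f g hf hg

end Coefficientwise

end Summit.CriticalPhenomena.PercolationContinuityZ3.Theorems
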